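import Summits.AtomisticToContinuum.HydrodynamicLimit.Theorems.InformationPercolationEngineChaosClosesEulerDissipationRigidityD
import Summits.AtomisticToContinuum.HydrodynamicLimit.Theorems.InformationPercolationEngineChaosClosesEulerMaxwellianMoments
import HarnessLib

/-!
# Dissipation rigidity — E: a finite measure whose Gaussian coarse-graining is log-quadratic is Gaussian

Helper for the line `empirical-h-theorem` of the crux `InformationPercolationEngine.ChaosClosesEuler`
(stmt-AtomisticToContinuum-15141), registered stub `stub_dissipationRigidity`.

Let `m` be a finite measure on `ℝ³`, `δ > 0`, and `g = m ∗ φδ` its Gaussian coarse-graining,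
`g(v) = ∫ φδ(v − w) dm(w)`.  If `log g(v) = a + ⟪b, v⟫ + c|v|²` for all `v`, then `m` is a Maxwellian measure
`M_{ρ,θ,u} dv` (`ρ, θ > 0`) or a point mass `ρ δ_u` (`exists_maxwellian_or_dirac_of_log_smoothedLaw_quadratic`):

* `∫ g dv = m(ℝ³) < ∞` (Tonelli) and `g ≤ m(ℝ³)(2πδ²)^{-3/2}` force `c < 0`, so completing the square
  `g = M_{ρ',s,u_g}` with `s = −1/(2c)`, `u_g = s b`;
* `g dv = m ∗ N(0, δ²)` as measures (Tonelli), so `charFun m · e^{−δ²|ξ|²/2} = ρ' e^{−s|ξ|²/2} e^{i⟨u_g,ξ⟩}`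
  (`charFun_conv`, characteristic function of the isotropic Gaussian, file D);
* `s < δ²` contradicts `|charFun m| ≤ m(ℝ³)`; `s = δ²` gives `charFun m = charFun (ρ' δ_{u_g})`;
  `s > δ²` gives `charFun m = charFun (ρ' N(u_g, s − δ²))`; conclude by `Measure.ext_of_charFun`.

References: folklore (Gaussian deconvolution by characteristic functions); C. Cercignani, R. Illner,
M. Pulvirenti, *The Mathematical Theory of Dilute Gases* (1994), §3.2.
-/

noncomputable section

namespace Summit.AtomisticToContinuum.HydrodynamicLimit.Theorems.ChaosClosesEulerDissipationRigidity

open scoped BigOperators Topology Classical MeasureTheory ENNReal InnerProductSpace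
open Filter Set MeasureTheory ProbabilityTheory Complex
open Literature.MathematicalPhysics.KineticTheory
open Literature.Analysis.FluidPDE
open Summit.AtomisticToContinuum.HydrodynamicLimit.Theorems

/-! ## The coarse-grained law as a measure -/

/-- **Total mass of the coarse-graining**: `∫ g dv = m(ℝ³)` (Tonelli; `∫ φδ = 1`). [folklore] -/
theorem lintegral_smoothedLaw {θ : ℝ} (hθ : 0 < θ) (m : Measure V3) [IsFiniteMeasure m] :
    ∫⁻ v, ENNReal.ofReal (∫ w, localMaxwellian 1 θ 0 (v - w) ∂m) = m Set.univ := by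
  have h2 : ∀ v : V3, ENNReal.ofReal (∫ w, localMaxwellian 1 θ 0 (v - w) ∂m) =
      ∫⁻ w, ENNReal.ofReal (localMaxwellian 1 θ w v) ∂m := by
    intro v
    rw [ofReal_integral_eq_lintegral_ofReal (integrable_phi_sub hθ m v)
      (Eventually.of_forall fun w => localMaxwellian_nonneg zero_le_one hθ.le _ _)]
    simp only [phi_sub_eq]
  simp_rw [h2]
  rw [lintegral_lintegral_swap]
  · have h3 : ∀ w : V3, ∫⁻ v, ENNReal.ofReal (localMaxwellian 1 θ w v) = 1 := fun w => by
      rw [← ofReal_integral_eq_lintegral_ofReal (integrable_localMaxwellian hθ w)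
        (Eventually.of_forall fun v => localMaxwellian_nonneg zero_le_one hθ.le _ _),
        integral_localMaxwellian_one hθ w, ENNReal.ofReal_one]
    simp_rw [h3]
    rw [lintegral_const, one_mul]
  · refine Continuous.aemeasurable ?_ |>.ennreal_ofReal
    have : Continuous fun p : V3 × V3 => localMaxwellian 1 θ 0 (p.1 - p.2) :=
      (continuous_localMaxwellian 1 θ 0).comp (continuous_fst.sub continuous_snd)
    simpa only [phi_sub_eq] using this

/-- **The coarse-grained law is the convolution**: `g dv = m ∗ N(0, δ²)` as measures on `ℝ³`. [folklore] -/
theorem withDensity_smoothedLaw_eq_conv {θ : ℝ} (hθ : 0 < θ) (m : Measure V3) [IsFiniteMeasure m] :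
    (volume : Measure V3).withDensity (fun v => ENNReal.ofReal (∫ w, localMaxwellian 1 θ 0 (v - w) ∂m)) =
      m ∗ gaussMeasure (0 : V3) θ := by
  ext S hS
  rw [withDensity_apply _ hS, Measure.conv, Measure.map_apply measurable_add hS,
    Measure.prod_apply (measurable_add hS)]
  have h1 : ∀ x : V3, gaussMeasure (0 : V3) θ (Prod.mk x ⁻¹' ((fun p : V3 × V3 => p.1 + p.2) ⁻¹' S)) =
      ∫⁻ v in S, ENNReal.ofReal (localMaxwellian 1 θ x v) := by
    intro x
    have : Prod.mk x ⁻¹' ((fun p : V3 × V3 => p.1 + p.2) ⁻¹' S) = (fun y => x + y) ⁻¹' S := rfl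
    rw [this, ← Measure.map_apply (measurable_const_add x) hS, gaussMeasure_map_const_add,
      ← withDensity_localMaxwellian_eq_gaussMeasure hθ x, withDensity_apply _ hS]
  simp_rw [h1]
  have h2 : ∀ v : V3, ENNReal.ofReal (∫ w, localMaxwellian 1 θ 0 (v - w) ∂m) =
      ∫⁻ w, ENNReal.ofReal (localMaxwellian 1 θ w v) ∂m := by
    intro v
    rw [ofReal_integral_eq_lintegral_ofReal (integrable_phi_sub hθ m v)
      (Eventually.of_forall fun w => localMaxwellian_nonneg zero_le_one hθ.le _ _)]
    simp only [phi_sub_eq]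
  simp_rw [h2]
  rw [lintegral_lintegral_swap]
  refine Continuous.aemeasurable ?_ |>.ennreal_ofReal
  have : Continuous fun p : V3 × V3 => localMaxwellian 1 θ 0 (p.1 - p.2) :=
    (continuous_localMaxwellian 1 θ 0).comp (continuous_fst.sub continuous_snd)
  simpa only [phi_sub_eq] using this

/-- **Characteristic function of the coarse-grained law**:
`charFun (g dv) ξ = charFun m ξ · e^{−θ|ξ|²/2}`. [folklore] -/
theorem charFun_withDensity_smoothedLaw {θ : ℝ} (hθ : 0 < θ) (m : Measure V3) [IsFiniteMeasure m] (ξ : V3) :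
    charFun ((volume : Measure V3).withDensity
        (fun v => ENNReal.ofReal (∫ w, localMaxwellian 1 θ 0 (v - w) ∂m))) ξ =
      charFun m ξ * cexp (-((θ * ‖ξ‖ ^ 2 / 2 : ℝ) : ℂ)) := by
  rw [withDensity_smoothedLaw_eq_conv hθ m, charFun_conv, charFun_gaussMeasure 0 hθ.le, inner_zero_left]
  push_cast
  rw [zero_mul, Complex.exp_zero, mul_one]

/-- The characteristic function of a scaled measure. [folklore] -/
theorem charFun_smul_measure (c : ℝ≥0∞) (μ : Measure V3) (ξ : V3) :
    charFun (c • μ) ξ = (c.toReal : ℂ) * charFun μ ξ := by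
  rw [charFun_apply, charFun_apply, integral_smul_measure, Complex.real_smul]

/-! ## Completing the square -/

/-- A unit vector of `ℝ³`. [folklore] -/
theorem exists_norm_eq_one : ∃ e : V3, ‖e‖ = 1 :=
  exists_norm_eq V3 zero_le_one

/-- **A bounded-above quadratic form has nonpositive leading coefficient, and is constant if the leading
coefficient vanishes**: if `a + ⟪b, v⟫ + c|v|² ≤ B` for all `v ∈ ℝ³` then `c ≤ 0`, and `c = 0 → b = 0`.
[folklore] -/
theorem quadratic_le_const {a c B : ℝ} {b : V3} (h : ∀ v : V3, a + ⟪b, v⟫_ℝ + c * ‖v‖ ^ 2 ≤ B) :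
    c ≤ 0 ∧ (c = 0 → b = 0) := by
  have hb : 0 ≤ c → b = 0 := fun hc => by
    by_contra hb
    have hb2 : 0 < ‖b‖ ^ 2 := by positivity
    set t : ℝ := (B - a + 1) / ‖b‖ ^ 2 with ht
    have h1 := h (t • b)
    rw [inner_smul_right, real_inner_self_eq_norm_sq, norm_smul, mul_pow, Real.norm_eq_abs, sq_abs] at h1
    have h2 : t * ‖b‖ ^ 2 = B - a + 1 := by rw [ht]; field_simp
    nlinarith [mul_nonneg hc (mul_nonneg (sq_nonneg t) (sq_nonneg ‖b‖))]
  refine ⟨?_, fun hc => hb hc.ge⟩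
  by_contra hc
  push Not at hc
  have hb0 := hb hc.le
  subst hb0
  obtain ⟨e, he⟩ := exists_norm_eq_one
  set t : ℝ := Real.sqrt ((B - a + 1) / c) + 1 with ht
  have h1 := h (t • e)
  rw [inner_zero_left, add_zero, norm_smul, he, mul_one, Real.norm_eq_abs, sq_abs] at h1
  have h3 : (B - a + 1) / c ≤ t ^ 2 := by
    rcases le_or_gt 0 ((B - a + 1) / c) with hx | hx
    · have h4 : Real.sqrt ((B - a + 1) / c) ^ 2 = (B - a + 1) / c := Real.sq_sqrt hx
      nlinarith [Real.sqrt_nonneg ((B - a + 1) / c)]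
    · nlinarith [sq_nonneg t]
  have h5 : B - a + 1 ≤ c * t ^ 2 := by
    have := mul_le_mul_of_nonneg_left h3 hc.le
    rwa [mul_div_cancel₀ _ hc.ne'] at this
  linarith

/-- **Completing the square**: for `c < 0`, `e^{a + ⟪b,v⟫ + c|v|²} = M_{ρ',s,u}(v)` with `s = −(2c)⁻¹`,
`u = s • b`, `ρ' = e^{a + |u|²/(2s)} (2πs)^{3/2} > 0`. [folklore] -/
theorem exp_quadratic_eq_localMaxwellian {a c : ℝ} (b : V3) (hc : c < 0) :
    ∃ ρ' s : ℝ, ∃ u : V3, 0 < ρ' ∧ 0 < s ∧ s = -(2 * c)⁻¹ ∧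
      ∀ v : V3, Real.exp (a + ⟪b, v⟫_ℝ + c * ‖v‖ ^ 2) = localMaxwellian ρ' s u v := by
  set s : ℝ := -(2 * c)⁻¹ with hs
  have hs0 : 0 < s := by
    rw [hs, neg_inv]
    exact inv_pos.2 (by linarith)
  set u : V3 := s • b with hu
  set cs : ℝ := (2 * Real.pi * s) ^ (-(Module.finrank ℝ V3 : ℝ) / 2) with hcs
  have hcs0 : 0 < cs := Real.rpow_pos_of_pos (by positivity) _
  refine ⟨Real.exp (a + ‖u‖ ^ 2 / (2 * s)) / cs, s, u, div_pos (Real.exp_pos _) hcs0, hs0, rfl, fun v => ?_⟩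
  rw [localMaxwellian, ← hcs, div_mul_cancel₀ _ hcs0.ne', ← Real.exp_add]
  congr 1
  have hcs' : c = -(2 * s)⁻¹ := by
    rw [hs]
    field_simp
  have hexp : ‖v - u‖ ^ 2 = ‖v‖ ^ 2 - 2 * ⟪v, u⟫_ℝ + ‖u‖ ^ 2 := by
    rw [← real_inner_self_eq_norm_sq, inner_sub_left, inner_sub_right, inner_sub_right,
      real_inner_self_eq_norm_sq, real_inner_self_eq_norm_sq, real_inner_comm u v]
    ring
  rw [hexp, hcs', hu, inner_smul_right, real_inner_comm v b]
  field_simp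
  ring

/-! ## Identification of the measure -/

/-- Lebesgue measure of `ℝ³` is infinite. [folklore] -/
theorem volume_univ_V3 : (volume : Measure V3) Set.univ = ∞ :=
  measure_univ_of_isAddLeftInvariant _

/-- **A finite measure whose Gaussian coarse-graining is log-quadratic is a Maxwellian measure or a point
mass.** If `g = m ∗ φδ > 0` satisfies `log g(v) = a + ⟪b, v⟫ + c|v|²`, then either
`m = M_{ρ,θ,u} dv` with `ρ, θ > 0`, or `m = ρ δ_u`. [folklore] -/
theorem exists_maxwellian_or_dirac_of_log_smoothedLaw_quadratic {δ : ℝ} (hδ : 0 < δ) (m : Measure V3)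
    [IsFiniteMeasure m] (hpos : ∀ v, 0 < ∫ w, localMaxwellian 1 (δ ^ 2) 0 (v - w) ∂m) {a c : ℝ} {b : V3}
    (hlog : ∀ v, Real.log (∫ w, localMaxwellian 1 (δ ^ 2) 0 (v - w) ∂m) = a + ⟪b, v⟫_ℝ + c * ‖v‖ ^ 2) :
    (∃ (ρ θ : ℝ) (u : V3), 0 < ρ ∧ 0 < θ ∧
      m = (volume : Measure V3).withDensity (fun v => ENNReal.ofReal (localMaxwellian ρ θ u v))) ∨
    (∃ (ρ : ℝ≥0∞) (u : V3), m = ρ • Measure.dirac u) := by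
  have hδ2 : 0 < δ ^ 2 := by positivity
  have hgexp : ∀ v, ∫ w, localMaxwellian 1 (δ ^ 2) 0 (v - w) ∂m = Real.exp (a + ⟪b, v⟫_ℝ + c * ‖v‖ ^ 2) :=
    fun v => by rw [← hlog v, Real.exp_log (hpos v)]
  -- the exponent is bounded above, so `c ≤ 0`, and `c = 0` forces a constant `g`, which is not integrable
  set B : ℝ := (m Set.univ).toReal * (2 * Real.pi * δ ^ 2) ^ (-(Module.finrank ℝ V3 : ℝ) / 2) with hB
  have hB0 : 0 < B := (hpos 0).trans_le (smoothedLaw_le hδ2 m 0)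
  have hle : ∀ v : V3, a + ⟪b, v⟫_ℝ + c * ‖v‖ ^ 2 ≤ Real.log B := fun v => by
    rw [← hlog v]
    exact Real.log_le_log (hpos v) (smoothedLaw_le hδ2 m v)
  obtain ⟨hc0, hcb⟩ := quadratic_le_const hle
  have hc : c < 0 := by
    rcases lt_or_eq_of_le hc0 with h | h
    · exact h
    · exfalso
      have hb := hcb h
      have h1 := lintegral_smoothedLaw hδ2 m
      have h2 : ∫⁻ v : V3, ENNReal.ofReal (∫ w, localMaxwellian 1 (δ ^ 2) 0 (v - w) ∂m) =
          ∫⁻ _v : V3, ENNReal.ofReal (Real.exp a) := lintegral_congr fun v => by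
        rw [hgexp v, hb, h, inner_zero_left, zero_mul, add_zero, add_zero]
      rw [h2, lintegral_const, volume_univ_V3, ENNReal.mul_top (ENNReal.ofReal_pos.2 (Real.exp_pos a)).ne']
        at h1
      exact (measure_ne_top m Set.univ) h1.symm
  -- complete the square: `g = M_{ρ',s,u}`
  obtain ⟨ρ', s, u, hρ', hs, -, hM⟩ := exp_quadratic_eq_localMaxwellian (a := a) b hc
  have hgM : (fun v => ENNReal.ofReal (∫ w, localMaxwellian 1 (δ ^ 2) 0 (v - w) ∂m)) =
      fun v => ENNReal.ofReal (localMaxwellian ρ' s u v) := funext fun v => by rw [hgexp v, hM v]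
  -- characteristic functions: `charFun m ξ e^{−δ²|ξ|²/2} = ρ' e^{−s|ξ|²/2} e^{i⟨u,ξ⟩}`
  have hchar : ∀ ξ : V3, charFun m ξ * cexp (-((δ ^ 2 * ‖ξ‖ ^ 2 / 2 : ℝ) : ℂ)) =
      (ρ' : ℂ) * (cexp (-((s * ‖ξ‖ ^ 2 / 2 : ℝ) : ℂ)) * cexp ((⟪u, ξ⟫_ℝ : ℂ) * I)) := by
    intro ξ
    rw [← charFun_withDensity_smoothedLaw hδ2 m ξ, hgM,
      ChaosClosesEulerMaxwellianMoments.withDensity_localMaxwellian_eq_smul_gaussMeasure hρ'.le hs u, charFun_smul_measure,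
      ENNReal.toReal_ofReal hρ'.le, charFun_gaussMeasure u hs.le]
  have hE : ∀ ξ : V3, cexp (-((δ ^ 2 * ‖ξ‖ ^ 2 / 2 : ℝ) : ℂ)) ≠ 0 := fun ξ => Complex.exp_ne_zero _
  rcases lt_trichotomy s (δ ^ 2) with hlt | heq | hgt
  · -- `s < δ²`: `|charFun m ξ| = ρ' e^{(δ²−s)|ξ|²/2}` is unbounded, contradicting `|charFun m| ≤ m(ℝ³)`
    exfalso
    have hnorm : ∀ ξ : V3, ‖charFun m ξ‖ = ρ' * Real.exp ((δ ^ 2 - s) * ‖ξ‖ ^ 2 / 2) := by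
      intro ξ
      have h := congrArg (fun z : ℂ => ‖z‖) (hchar ξ)
      rw [norm_mul, norm_mul, norm_mul, Complex.norm_exp_ofReal_mul_I, mul_one, Complex.norm_real,
        Real.norm_eq_abs, abs_of_pos hρ', Complex.norm_exp, Complex.norm_exp] at h
      simp only [Complex.neg_re, Complex.ofReal_re] at h
      calc ‖charFun m ξ‖ = ‖charFun m ξ‖ * Real.exp (-(δ ^ 2 * ‖ξ‖ ^ 2 / 2)) *
            Real.exp (δ ^ 2 * ‖ξ‖ ^ 2 / 2) := by
            rw [mul_assoc, ← Real.exp_add, neg_add_cancel, Real.exp_zero, mul_one]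
        _ = ρ' * Real.exp (-(s * ‖ξ‖ ^ 2 / 2)) * Real.exp (δ ^ 2 * ‖ξ‖ ^ 2 / 2) := by rw [h]
        _ = ρ' * Real.exp ((δ ^ 2 - s) * ‖ξ‖ ^ 2 / 2) := by
            rw [mul_assoc, ← Real.exp_add]
            congr 2
            ring
    obtain ⟨e, he⟩ := exists_norm_eq_one
    set X : ℝ := 2 * (m.real Set.univ / ρ' + 1) / (δ ^ 2 - s) with hX
    have hX0 : 0 ≤ X := by
      have : 0 < δ ^ 2 - s := sub_pos.2 hlt
      positivity
    have hξ : ‖Real.sqrt X • e‖ ^ 2 = X := by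
      rw [norm_smul, he, mul_one, Real.norm_eq_abs, abs_of_nonneg (Real.sqrt_nonneg X), Real.sq_sqrt hX0]
    have h1 := hnorm (Real.sqrt X • e)
    rw [hξ] at h1
    have h2 : (δ ^ 2 - s) * X / 2 = m.real Set.univ / ρ' + 1 := by
      rw [hX]
      field_simp
    rw [h2] at h1
    have h3 := norm_charFun_le (μ := m) (Real.sqrt X • e)
    rw [h1] at h3
    have h4 : m.real Set.univ / ρ' + 1 + 1 ≤ Real.exp (m.real Set.univ / ρ' + 1) := Real.add_one_le_exp _
    have h5 : ρ' * (m.real Set.univ / ρ' + 1 + 1) = m.real Set.univ + 2 * ρ' := by field_simp; ring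
    nlinarith [mul_le_mul_of_nonneg_left h4 hρ'.le]
  · -- `s = δ²`: `m` is the point mass `ρ' δ_u`
    right
    haveI : IsFiniteMeasure (ENNReal.ofReal ρ' • Measure.dirac u) := ⟨by
      rw [Measure.smul_apply, smul_eq_mul]
      exact ENNReal.mul_lt_top ENNReal.ofReal_lt_top (measure_lt_top _ _)⟩
    refine ⟨ENNReal.ofReal ρ', u, Measure.ext_of_charFun (funext fun ξ => ?_)⟩
    rw [charFun_smul_measure, ENNReal.toReal_ofReal hρ'.le, charFun_dirac]
    have h := hchar ξ
    rw [heq] at h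
    have h' : charFun m ξ * cexp (-((δ ^ 2 * ‖ξ‖ ^ 2 / 2 : ℝ) : ℂ)) =
        ((ρ' : ℂ) * cexp ((⟪u, ξ⟫_ℝ : ℂ) * I)) * cexp (-((δ ^ 2 * ‖ξ‖ ^ 2 / 2 : ℝ) : ℂ)) := by
      rw [h]; ring
    exact mul_right_cancel₀ (hE ξ) h'
  · -- `s > δ²`: `m` is the Maxwellian measure `M_{ρ', s − δ², u}`
    left
    have hθ : 0 < s - δ ^ 2 := sub_pos.2 hgt
    refine ⟨ρ', s - δ ^ 2, u, hρ', hθ, ?_⟩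
    rw [ChaosClosesEulerMaxwellianMoments.withDensity_localMaxwellian_eq_smul_gaussMeasure hρ'.le hθ u]
    haveI : IsFiniteMeasure (ENNReal.ofReal ρ' • gaussMeasure u (s - δ ^ 2)) := ⟨by
      rw [Measure.smul_apply, smul_eq_mul]
      exact ENNReal.mul_lt_top ENNReal.ofReal_lt_top (measure_lt_top _ _)⟩
    refine Measure.ext_of_charFun (funext fun ξ => ?_)
    rw [charFun_smul_measure, ENNReal.toReal_ofReal hρ'.le, charFun_gaussMeasure u hθ.le]
    have h := hchar ξ
    have hsplit : cexp (-((s * ‖ξ‖ ^ 2 / 2 : ℝ) : ℂ)) =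
        cexp (-(((s - δ ^ 2) * ‖ξ‖ ^ 2 / 2 : ℝ) : ℂ)) * cexp (-((δ ^ 2 * ‖ξ‖ ^ 2 / 2 : ℝ) : ℂ)) := by
      rw [← Complex.exp_add]
      congr 1
      push_cast
      ring
    rw [hsplit] at h
    have h' : charFun m ξ * cexp (-((δ ^ 2 * ‖ξ‖ ^ 2 / 2 : ℝ) : ℂ)) =
        ((ρ' : ℂ) * (cexp (-(((s - δ ^ 2) * ‖ξ‖ ^ 2 / 2 : ℝ) : ℂ)) * cexp ((⟪u, ξ⟫_ℝ : ℂ) * I))) *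
          cexp (-((δ ^ 2 * ‖ξ‖ ^ 2 / 2 : ℝ) : ℂ)) := by
      rw [h]; ring
    exact mul_right_cancel₀ (hE ξ) h'

/-! ## Registered sub-goal -/

/-- **Registered sub-goal `stub_dissipationRigidityE` (helper E of `stub_dissipationRigidity`): a finite
measure on `ℝ³` whose Gaussian coarse-graining is log-quadratic is a Maxwellian measure or a point mass.**
[folklore] -/
theorem stub_dissipationRigidityE : ∀ {δ : ℝ}, 0 < δ → ∀ (m : Measure V3) [IsFiniteMeasure m], (∀ v, 0 < ∫ w, localMaxwellian 1 (δ ^ 2) 0 (v - w) ∂m) → ∀ {a c : ℝ} {b : V3}, (∀ v, Real.log (∫ w, localMaxwellian 1 (δ ^ 2) 0 (v - w) ∂m) = a + ⟪b, v⟫_ℝ + c * ‖v‖ ^ 2) → (∃ (ρ θ : ℝ) (u : V3), 0 < ρ ∧ 0 < θ ∧ m = (volume : Measure V3).withDensity (fun v => ENNReal.ofReal (localMaxwellian ρ θ u v))) ∨ (∃ (ρ : ℝ≥0∞) (u : V3), m = ρ • Measure.dirac u) :=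
  fun hδ m _ hpos _ _ _ hlog => exists_maxwellian_or_dirac_of_log_smoothedLaw_quadratic hδ m hpos hlog

end Summit.AtomisticToContinuum.HydrodynamicLimit.Theorems.ChaosClosesEulerDissipationRigidity

end
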